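import Summits.QuantumFields.QCD.Theorems.HeatSlicedQuarksQuarkLoopCoefficientHeatSeries

/-!
# Quark-loop coefficient, stub `secondOrderCoefficient`, part A: free-symbol algebra

Helper file of the line `Sketch` of crux stmt-QuantumFields-16786 (stub `stub_secondOrderCoefficient`:
`e2 t → 1/(12π²)` at rate `C/t`).  Finite algebra of the free Dirac symbol `ď = dsymb`, `ď♯ = dsharp` on
`nbr 0 = {0, ±e_μ}`: the values `ď(0) = 4`, `ď(±e_μ) = −½(1 ∓ γ_μ)`, `ď♯(±e_μ) = −½(1 ± γ_μ)`; the generating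
sums `Σ_u ď(u) = 0`, `Σ_u u_μ ď(u) = γ_μ`, `Σ_z ď♯(z) = 0`, `Σ_z z_μ ď♯(z) = −γ_μ`; the support reindexing
`Σ_{v ∈ nbr2 0} Σ_{z ∈ nbr 0} f z (v − z) = Σ_{z,u ∈ nbr 0} f z u`; and, from the scalar free `D♯D` symbol
(`sqKer 1 x y = ĥ(y−x)·1`, conjunct (1) of the line's `FreeHeatCalculus`, a hypothesis here), the moments
`Σ_v v_μ ĥ(v) = 0`, `Σ_v v_μ v_ν ĥ(v) = −2δ_{μν}` and the first-order vertex sum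
`Σ_{v,z} (i/2)(z∧v) ď♯(z)ď(v−z) = −iγ₀γ₁`, whose square has trace `4` (the number behind `1/(8π²)`).
Mathlib + the Defs file + the shared `HeatSeries` layer + the tree's Clifford algebra of `euclideanGamma`.
-/
noncomputable section

namespace Summit.QuantumFields.QCD.Cruxes.QuarkLoopCoefficient.Sketch.SecondOrderCoefficient

open Literature.MathematicalPhysics.QuantumLattice Literature.MathematicalPhysics.QuantumFieldTheory
open Literature.Probability.LatticeModels (Site)
open Summit.QuantumFields.QCD.Theorems.QuarkLoopCoefficient
open Summit.QuantumFields.QCD.Cruxes.QuarkLoopCoefficient.Sketch.HeatSeries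
open scoped Matrix ComplexConjugate

attribute [local irreducible] nbr nbr2

/-! ## Unit vectors and sums over `nbr 0` -/

/-- `e_μ ≠ 0`. -/
theorem single_ne_zero (μ : Fin 4) : (Pi.single μ 1 : Site 4) ≠ 0 := fun h => by
  simpa using congrFun h μ

/-- `e_μ ≠ −e_ν`. -/
theorem single_ne_neg_single (μ ν : Fin 4) : (Pi.single μ 1 : Site 4) ≠ -Pi.single ν 1 := fun h => by
  have := congrFun h μ
  by_cases hμν : μ = ν
  · subst hμν; simp at this
  · simp [hμν] at this

/-- `e_μ = e_ν ↔ μ = ν`. -/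
theorem single_eq_single_iff {μ ν : Fin 4} : (Pi.single μ 1 : Site 4) = Pi.single ν 1 ↔ μ = ν := by
  constructor
  · intro h
    by_contra hne
    have := congrFun h μ
    simp [hne] at this
  · rintro rfl; rfl

/-- Coordinates of `e_ν`, cast to `ℂ`. -/
theorem single_apply_cast (μ ν : Fin 4) :
    (((Pi.single ν 1 : Site 4) μ : ℤ) : ℂ) = if μ = ν then 1 else 0 := by
  rw [Pi.single_apply]; split_ifs <;> simp

/-- Coordinates of `−e_ν`, cast to `ℂ`. -/
theorem neg_single_apply_cast (μ ν : Fin 4) :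
    (((-Pi.single ν 1 : Site 4) μ : ℤ) : ℂ) = if μ = ν then -1 else 0 := by
  rw [Pi.neg_apply, Pi.single_apply]; split_ifs <;> simp

/-- Sums over the range-one neighbourhood of the origin, written out: `nbr 0 = {0} ∪ {±e_μ}`. -/
theorem sum_nbr_zero {β : Type*} [AddCommMonoid β] (f : Site 4 → β) :
    ∑ z ∈ nbr 0, f z = f 0 + ∑ μ : Fin 4, (f (Pi.single μ 1) + f (-Pi.single μ 1)) := by
  unfold nbr
  rw [Finset.sum_insert]
  · congr 1
    rw [Finset.sum_biUnion]
    · refine Finset.sum_congr rfl fun μ _ => ?_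
      rw [zero_add, zero_sub, Finset.sum_pair]
      exact single_ne_neg_single μ μ
    · intro μ _ ν _ hμν
      simp only [zero_add, zero_sub]
      rw [Function.onFun, Finset.disjoint_left]
      intro a ha hb
      simp only [Finset.mem_insert, Finset.mem_singleton] at ha hb
      rcases ha with rfl | rfl <;> rcases hb with h | h
      · exact hμν (single_eq_single_iff.mp h)
      · exact single_ne_neg_single μ ν h
      · exact single_ne_neg_single ν μ h.symm
      · exact hμν (single_eq_single_iff.mp (neg_injective h))
  · simp only [zero_add, zero_sub, Finset.mem_biUnion, Finset.mem_univ, true_and, Finset.mem_insert,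
      Finset.mem_singleton, not_exists, not_or]
    exact fun μ => ⟨(single_ne_zero μ).symm, fun h => single_ne_zero μ (neg_eq_zero.mp h.symm)⟩

/-- `u ∈ nbr 0`, `z ∈ nbr 0` ⇒ `u + z ∈ nbr2 0`. -/
theorem add_mem_nbr2_zero {u z : Site 4} (hu : u ∈ nbr 0) (hz : z ∈ nbr 0) : u + z ∈ nbr2 0 := by
  have huz : u + z ∈ nbr z := by
    rcases mem_nbr.mp hu with h | ⟨μ, h | h⟩
    · rw [h, zero_add]; exact self_mem_nbr z
    · rw [h, zero_add, add_comm]; exact add_single_mem_nbr z μ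
    · rw [h, zero_sub, add_comm, ← sub_eq_add_neg]; exact sub_single_mem_nbr z μ
  exact mem_nbr2.mpr ⟨z, hz, huz⟩

/-- Support reindexing: a double sum over `v ∈ nbr2 0`, `z ∈ nbr 0` of a function of `(z, v − z)`
vanishing unless `v − z ∈ nbr 0` is the double sum over `z, u ∈ nbr 0`. -/
theorem sum_nbr2_nbr_shift {β : Type*} [AddCommMonoid β] (f : Site 4 → Site 4 → β)
    (hf : ∀ z u, u ∉ nbr 0 → f z u = 0) :
    ∑ v ∈ nbr2 0, ∑ z ∈ nbr 0, f z (v - z) = ∑ z ∈ nbr 0, ∑ u ∈ nbr 0, f z u := by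
  rw [Finset.sum_comm]
  refine Finset.sum_congr rfl fun z hz => ?_
  have hmap : ∑ u ∈ nbr 0, f z u = ∑ v ∈ (nbr 0).map (Equiv.addRight z).toEmbedding, f z (v - z) := by
    rw [Finset.sum_map]
    simp
  rw [hmap]
  symm
  refine Finset.sum_subset ?_ ?_
  · intro v hv
    obtain ⟨u, hu, rfl⟩ := Finset.mem_map.mp hv
    exact add_mem_nbr2_zero hu hz
  · refine fun v _ hv => hf _ _ fun hvz => hv ?_
    exact Finset.mem_map.mpr ⟨v - z, hvz, by simp⟩

/-! ## Values of the free Dirac symbol and its adjoint -/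

/-- `ď(0) = 4·1`. -/
theorem dsymb_zero : dsymb 0 = (4 : ℂ) • (1 : Spin) := by
  unfold dsymb diracKer
  have h : ∀ μ : Fin 4, ((0 : Site 4) = Pi.single μ 1 ↔ False) := fun μ =>
    ⟨fun h => single_ne_zero μ h.symm, False.elim⟩
  simp [h]

/-- `ď(e_μ) = −½(1 − γ_μ)`. -/
theorem dsymb_single (μ : Fin 4) :
    dsymb (Pi.single μ 1) = -((1 / 2 : ℂ) • ((1 : Spin) - euclideanGamma μ)) := by
  unfold dsymb diracKer
  have h0 : (0 : Site 4) ≠ Pi.single μ 1 := (single_ne_zero μ).symm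
  have h1 : ∀ ν : Fin 4, (Pi.single μ 1 : Site 4) = 0 + Pi.single ν 1 ↔ ν = μ := fun ν => by
    rw [zero_add, single_eq_single_iff, eq_comm]
  have h2 : ∀ ν : Fin 4, (0 : Site 4) ≠ Pi.single μ 1 + Pi.single ν 1 := fun ν h => by
    have := congrFun h ν
    by_cases hμν : μ = ν
    · subst hμν; simp at this
    · simp [Ne.symm hμν] at this
  simp only [h0, if_false, h1, h2, zero_sub, Finset.sum_ite_eq', Finset.mem_univ, if_true, one_smul,
    add_zero]

/-- `ď(−e_μ) = −½(1 + γ_μ)`. -/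
theorem dsymb_neg_single (μ : Fin 4) :
    dsymb (-Pi.single μ 1) = -((1 / 2 : ℂ) • ((1 : Spin) + euclideanGamma μ)) := by
  unfold dsymb diracKer
  have h0 : (0 : Site 4) ≠ -Pi.single μ 1 := fun h => single_ne_zero μ (neg_eq_zero.mp h.symm)
  have h1 : ∀ ν : Fin 4, ((-Pi.single μ 1 : Site 4) = Pi.single ν 1 ↔ False) := fun ν =>
    ⟨fun h => single_ne_neg_single ν μ h.symm, False.elim⟩
  have h2 : ∀ ν : Fin 4, (0 : Site 4) = -Pi.single μ 1 + Pi.single ν 1 ↔ ν = μ := fun ν => by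
    rw [eq_comm, neg_add_eq_zero, single_eq_single_iff, eq_comm]
  simp only [h0, if_false, h1, h2, zero_sub, Finset.sum_ite_eq', Finset.mem_univ, if_true, one_smul,
    zero_add, map_one]

/-- Off the range-one neighbourhood the free Dirac symbol vanishes. -/
theorem dsymb_eq_zero {u : Site 4} (hu : u ∉ nbr 0) : dsymb u = 0 := diracKer_eq_zero hu

/-- `ď♯(0) = 4·1`. -/
theorem dsharp_zero : dsharp 0 = (4 : ℂ) • (1 : Spin) := by
  unfold dsharp
  rw [neg_zero, dsymb_zero, Matrix.conjTranspose_smul, Matrix.conjTranspose_one]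
  norm_num

/-- `ď♯(e_μ) = −½(1 + γ_μ)`. -/
theorem dsharp_single (μ : Fin 4) :
    dsharp (Pi.single μ 1) = -((1 / 2 : ℂ) • ((1 : Spin) + euclideanGamma μ)) := by
  unfold dsharp
  rw [dsymb_neg_single, Matrix.conjTranspose_neg, Matrix.conjTranspose_smul, Matrix.conjTranspose_add,
    Matrix.conjTranspose_one, (euclideanGamma_isHermitian μ).eq]
  norm_num

/-- `ď♯(−e_μ) = −½(1 − γ_μ)`. -/
theorem dsharp_neg_single (μ : Fin 4) :
    dsharp (-Pi.single μ 1) = -((1 / 2 : ℂ) • ((1 : Spin) - euclideanGamma μ)) := by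
  unfold dsharp
  rw [neg_neg, dsymb_single, Matrix.conjTranspose_neg, Matrix.conjTranspose_smul, Matrix.conjTranspose_sub,
    Matrix.conjTranspose_one, (euclideanGamma_isHermitian μ).eq]
  norm_num

/-! ## Generating sums -/

/-- `Σ_{u ∈ nbr 0} ď(u) = 0` (the free massless symbol vanishes at zero momentum). -/
theorem sum_dsymb : ∑ u ∈ nbr 0, dsymb u = 0 := by
  rw [sum_nbr_zero, dsymb_zero]
  simp only [dsymb_single, dsymb_neg_single]
  have : ∀ μ : Fin 4, -((1 / 2 : ℂ) • ((1 : Spin) - euclideanGamma μ)) +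
      -((1 / 2 : ℂ) • ((1 : Spin) + euclideanGamma μ)) = -(1 : Spin) := fun μ => by
    rw [← neg_add, ← smul_add, sub_add_add_cancel, ← two_smul ℂ (1 : Spin), smul_smul]; norm_num
  simp only [this, Finset.sum_neg_distrib, Finset.sum_const, Finset.card_univ, Fintype.card_fin]
  rw [← Nat.cast_smul_eq_nsmul ℂ]
  norm_num

/-- `Σ_{z ∈ nbr 0} ď♯(z) = 0`. -/
theorem sum_dsharp : ∑ z ∈ nbr 0, dsharp z = 0 := by
  rw [sum_nbr_zero, dsharp_zero]
  simp only [dsharp_single, dsharp_neg_single]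
  have : ∀ μ : Fin 4, -((1 / 2 : ℂ) • ((1 : Spin) + euclideanGamma μ)) +
      -((1 / 2 : ℂ) • ((1 : Spin) - euclideanGamma μ)) = -(1 : Spin) := fun μ => by
    rw [← neg_add, ← smul_add, add_add_sub_cancel, ← two_smul ℂ (1 : Spin), smul_smul]; norm_num
  simp only [this, Finset.sum_neg_distrib, Finset.sum_const, Finset.card_univ, Fintype.card_fin]
  rw [← Nat.cast_smul_eq_nsmul ℂ]
  norm_num

/-- `Σ_{u ∈ nbr 0} u_μ ď(u) = γ_μ`. -/
theorem sum_smul_dsymb (μ : Fin 4) :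
    ∑ u ∈ nbr 0, (((u μ : ℤ) : ℂ)) • dsymb u = euclideanGamma μ := by
  rw [sum_nbr_zero]
  simp only [Pi.zero_apply, Int.cast_zero, zero_smul, zero_add, single_apply_cast, neg_single_apply_cast,
    ite_smul, one_smul, neg_smul, zero_smul, Finset.sum_ite_eq,
    Finset.mem_univ, if_true, Finset.sum_add_distrib, dsymb_single, dsymb_neg_single]
  rw [neg_neg, ← smul_neg, ← smul_add, neg_sub,
    show euclideanGamma μ - 1 + (1 + euclideanGamma μ) = (2 : ℂ) • euclideanGamma μ by rw [two_smul]; abel,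
    smul_smul]
  norm_num

/-- `Σ_{z ∈ nbr 0} z_μ ď♯(z) = −γ_μ`. -/
theorem sum_smul_dsharp (μ : Fin 4) :
    ∑ z ∈ nbr 0, (((z μ : ℤ) : ℂ)) • dsharp z = -euclideanGamma μ := by
  rw [sum_nbr_zero]
  simp only [Pi.zero_apply, Int.cast_zero, zero_smul, zero_add, single_apply_cast, neg_single_apply_cast,
    ite_smul, one_smul, neg_smul, zero_smul, Finset.sum_ite_eq, Finset.mem_univ, if_true,
    Finset.sum_add_distrib, dsharp_single, dsharp_neg_single]
  rw [neg_neg, ← smul_neg, ← smul_add, neg_add,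
    show -(1 : Spin) + -euclideanGamma μ + (1 - euclideanGamma μ) = (2 : ℂ) • (-euclideanGamma μ) by
      rw [two_smul]; abel,
    smul_smul]
  norm_num

/-! ## The scalar free `D♯D` symbol and its moments -/

/-- Translation invariance of the free Dirac kernel (trivial link field). -/
theorem diracKer_one_translate (x y a : Site 4) :
    diracKer (fun _ => (1 : ℂ)) (x + a) (y + a) = diracKer (fun _ => (1 : ℂ)) x y := by
  unfold diracKer
  have h1 : (x + a = y + a) ↔ x = y := add_left_inj a
  have h2 : ∀ μ : Fin 4, (y + a = x + a + Pi.single μ 1 ↔ y = x + Pi.single μ 1) := fun μ => by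
    rw [add_right_comm, add_left_inj]
  have h3 : ∀ μ : Fin 4, (x + a = y + a + Pi.single μ 1 ↔ x = y + Pi.single μ 1) := fun μ => by
    rw [add_right_comm, add_left_inj]
  simp only [h1, h2, h3]

/-- From the scalar free `D♯D` symbol (`sqKer 1 x y = ĥ(y−x)·1`, conjunct (1) of `FreeHeatCalculus`):
`Σ_{z ∈ nbr 0} ď♯(z) ď(v − z) = ĥ(v)·1` for every `v`. -/
theorem sum_dsharp_mul_dsymb
    (hsq : ∀ x y : Site 4, sqKer (fun _ => (1 : ℂ)) x y = ((hhat (y - x) : ℝ) : ℂ) • (1 : Spin))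
    (v : Site 4) :
    ∑ z ∈ nbr 0, dsharp z * dsymb (v - z) = ((hhat v : ℝ) : ℂ) • (1 : Spin) := by
  have h := hsq 0 v
  rw [sub_zero] at h
  rw [← h]
  unfold sqKer dsharp dsymb
  refine Finset.sum_congr rfl fun z _ => ?_
  congr 1
  · rw [← diracKer_one_translate 0 (-z) z, zero_add, neg_add_cancel]
  · rw [← diracKer_one_translate 0 (v - z) z, zero_add, sub_add_cancel]

/-- Scalars are read off from scalar matrices. -/
theorem smul_one_eq_smul_one_iff {a b : ℂ} : a • (1 : Spin) = b • (1 : Spin) ↔ a = b :=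
  ⟨fun h => by simpa using congrFun (congrFun h 0) 0, fun h => by rw [h]⟩

/-- First moments of `ĥ` vanish: `Σ_{v ∈ nbr2 0} v_μ ĥ(v) = 0`. -/
theorem sum_coord_mul_hhat
    (hsq : ∀ x y : Site 4, sqKer (fun _ => (1 : ℂ)) x y = ((hhat (y - x) : ℝ) : ℂ) • (1 : Spin))
    (μ : Fin 4) :
    ∑ v ∈ nbr2 0, ((v μ : ℤ) : ℝ) * hhat v = 0 := by
  have key : (∑ v ∈ nbr2 0, ((v μ : ℤ) : ℂ) * ((hhat v : ℝ) : ℂ)) • (1 : Spin) = 0 := by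
    calc (∑ v ∈ nbr2 0, ((v μ : ℤ) : ℂ) * ((hhat v : ℝ) : ℂ)) • (1 : Spin)
        = ∑ v ∈ nbr2 0, ((v μ : ℤ) : ℂ) • ∑ z ∈ nbr 0, dsharp z * dsymb (v - z) := by
          rw [Finset.sum_smul]
          refine Finset.sum_congr rfl fun v _ => ?_
          rw [sum_dsharp_mul_dsymb hsq, smul_smul]
      _ = ∑ v ∈ nbr2 0, ∑ z ∈ nbr 0, (((v - z + z) μ : ℤ) : ℂ) • (dsharp z * dsymb (v - z)) := by
          refine Finset.sum_congr rfl fun v _ => ?_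
          rw [Finset.smul_sum]
          simp only [sub_add_cancel]
      _ = ∑ z ∈ nbr 0, ∑ u ∈ nbr 0, (((u + z) μ : ℤ) : ℂ) • (dsharp z * dsymb u) :=
          sum_nbr2_nbr_shift (fun z u => (((u + z) μ : ℤ) : ℂ) • (dsharp z * dsymb u))
            (fun z u hu => by rw [dsymb_eq_zero hu, Matrix.mul_zero, smul_zero])
      _ = ∑ z ∈ nbr 0, (dsharp z * ∑ u ∈ nbr 0, ((u μ : ℤ) : ℂ) • dsymb u +
            (((z μ : ℤ) : ℂ) • dsharp z) * ∑ u ∈ nbr 0, dsymb u) := by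
          refine Finset.sum_congr rfl fun z _ => ?_
          rw [Finset.mul_sum, Finset.mul_sum, ← Finset.sum_add_distrib]
          refine Finset.sum_congr rfl fun u _ => ?_
          rw [Pi.add_apply, Int.cast_add, add_smul, Matrix.mul_smul, Matrix.smul_mul]
      _ = 0 := by
          rw [Finset.sum_add_distrib, ← Finset.sum_mul, ← Finset.sum_mul, sum_smul_dsymb, sum_dsymb,
            sum_dsharp, Matrix.zero_mul, Matrix.mul_zero, add_zero]
  rw [← zero_smul ℂ (1 : Spin), smul_one_eq_smul_one_iff] at key
  exact_mod_cast key

/-- Second moments of `ĥ`: `Σ_{v ∈ nbr2 0} v_μ v_ν ĥ(v) = −2 δ_{μν}` (the Hessian of the free symbol at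
the origin is `2·1`; here from the Clifford relations). -/
theorem sum_coord_mul_coord_mul_hhat
    (hsq : ∀ x y : Site 4, sqKer (fun _ => (1 : ℂ)) x y = ((hhat (y - x) : ℝ) : ℂ) • (1 : Spin))
    (μ ν : Fin 4) :
    ∑ v ∈ nbr2 0, ((v μ : ℤ) : ℝ) * ((v ν : ℤ) : ℝ) * hhat v = if μ = ν then -2 else 0 := by
  have key : (∑ v ∈ nbr2 0, ((v μ : ℤ) : ℂ) * ((v ν : ℤ) : ℂ) * ((hhat v : ℝ) : ℂ)) • (1 : Spin) =
      -(euclideanGamma ν * euclideanGamma μ + euclideanGamma μ * euclideanGamma ν) := by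
    calc (∑ v ∈ nbr2 0, ((v μ : ℤ) : ℂ) * ((v ν : ℤ) : ℂ) * ((hhat v : ℝ) : ℂ)) • (1 : Spin)
        = ∑ v ∈ nbr2 0, (((v μ : ℤ) : ℂ) * ((v ν : ℤ) : ℂ)) • ∑ z ∈ nbr 0, dsharp z * dsymb (v - z) := by
          rw [Finset.sum_smul]
          refine Finset.sum_congr rfl fun v _ => ?_
          rw [sum_dsharp_mul_dsymb hsq, smul_smul]
      _ = ∑ v ∈ nbr2 0, ∑ z ∈ nbr 0,
            ((((v - z + z) μ : ℤ) : ℂ) * (((v - z + z) ν : ℤ) : ℂ)) • (dsharp z * dsymb (v - z)) := by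
          refine Finset.sum_congr rfl fun v _ => ?_
          rw [Finset.smul_sum]
          simp only [sub_add_cancel]
      _ = ∑ z ∈ nbr 0, ∑ u ∈ nbr 0, ((((u + z) μ : ℤ) : ℂ) * (((u + z) ν : ℤ) : ℂ)) • (dsharp z * dsymb u) :=
          sum_nbr2_nbr_shift (fun z u => ((((u + z) μ : ℤ) : ℂ) * (((u + z) ν : ℤ) : ℂ)) • (dsharp z * dsymb u))
            (fun z u hu => by rw [dsymb_eq_zero hu, Matrix.mul_zero, smul_zero])
      _ = ∑ z ∈ nbr 0, (dsharp z * ∑ u ∈ nbr 0, (((u μ : ℤ) : ℂ) * ((u ν : ℤ) : ℂ)) • dsymb u +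
            (((z ν : ℤ) : ℂ) • dsharp z) * ∑ u ∈ nbr 0, ((u μ : ℤ) : ℂ) • dsymb u +
            (((z μ : ℤ) : ℂ) • dsharp z) * ∑ u ∈ nbr 0, ((u ν : ℤ) : ℂ) • dsymb u +
            ((((z μ : ℤ) : ℂ) * ((z ν : ℤ) : ℂ)) • dsharp z) * ∑ u ∈ nbr 0, dsymb u) := by
          refine Finset.sum_congr rfl fun z _ => ?_
          rw [Finset.mul_sum, Finset.mul_sum, Finset.mul_sum, Finset.mul_sum, ← Finset.sum_add_distrib,
            ← Finset.sum_add_distrib, ← Finset.sum_add_distrib]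
          refine Finset.sum_congr rfl fun u _ => ?_
          simp only [Pi.add_apply, Int.cast_add, Matrix.mul_smul, Matrix.smul_mul, smul_smul, ← add_smul]
          congr 1
          ring
      _ = -(euclideanGamma ν * euclideanGamma μ + euclideanGamma μ * euclideanGamma ν) := by
          rw [Finset.sum_add_distrib, Finset.sum_add_distrib, Finset.sum_add_distrib, ← Finset.sum_mul,
            ← Finset.sum_mul, ← Finset.sum_mul, ← Finset.sum_mul, sum_smul_dsymb, sum_smul_dsymb, sum_dsymb,
            sum_dsharp, sum_smul_dsharp, sum_smul_dsharp, Matrix.zero_mul, Matrix.mul_zero, zero_add,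
            add_zero, Matrix.neg_mul, Matrix.neg_mul, neg_add]
  have key' : (∑ v ∈ nbr2 0, ((v μ : ℤ) : ℂ) * ((v ν : ℤ) : ℂ) * ((hhat v : ℝ) : ℂ)) • (1 : Spin) =
      ((if μ = ν then -2 else 0 : ℝ) : ℂ) • (1 : Spin) := by
    rw [key]
    split_ifs with h
    · subst h
      rw [euclideanGamma_mul_self, ← two_smul ℂ (1 : Spin), ← neg_smul]
      norm_num
    · rw [euclideanGamma_mul_of_ne (Ne.symm h), neg_add_cancel, neg_zero]
      simp
  rw [smul_one_eq_smul_one_iff] at key'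
  exact_mod_cast key'

/-! ## The first-order vertex sum and the trace `4` -/

/-- `z ∧ (u + z) = z ∧ u`. -/
theorem wedge_add_self_right (z u : Site 4) : wedge z (u + z) = wedge z u := by unfold wedge; simp; ring

/-- The zero-momentum first-order vertex: `Σ_{v ∈ nbr2 0} Σ_{z ∈ nbr 0} (i/2)(z∧v) ď♯(z) ď(v−z) = −i γ₀γ₁`. -/
theorem sum_vertexOne :
    ∑ v ∈ nbr2 0, ∑ z ∈ nbr 0, (Complex.I / 2 * ((wedge z v : ℤ) : ℂ)) • (dsharp z * dsymb (v - z)) =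
      -(Complex.I • (euclideanGamma 0 * euclideanGamma 1)) := by
  calc ∑ v ∈ nbr2 0, ∑ z ∈ nbr 0, (Complex.I / 2 * ((wedge z v : ℤ) : ℂ)) • (dsharp z * dsymb (v - z))
      = ∑ v ∈ nbr2 0, ∑ z ∈ nbr 0,
          (Complex.I / 2 * ((wedge z (v - z + z) : ℤ) : ℂ)) • (dsharp z * dsymb (v - z)) := by
        simp only [sub_add_cancel]
    _ = ∑ z ∈ nbr 0, ∑ u ∈ nbr 0, (Complex.I / 2 * ((wedge z (u + z) : ℤ) : ℂ)) • (dsharp z * dsymb u) :=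
        sum_nbr2_nbr_shift (fun z u => (Complex.I / 2 * ((wedge z (u + z) : ℤ) : ℂ)) • (dsharp z * dsymb u))
          (fun z u hu => by rw [dsymb_eq_zero hu, Matrix.mul_zero, smul_zero])
    _ = (Complex.I / 2) • ∑ z ∈ nbr 0,
          ((((z 0 : ℤ) : ℂ) • dsharp z) * ∑ u ∈ nbr 0, ((u 1 : ℤ) : ℂ) • dsymb u -
            (((z 1 : ℤ) : ℂ) • dsharp z) * ∑ u ∈ nbr 0, ((u 0 : ℤ) : ℂ) • dsymb u) := by
        rw [Finset.smul_sum]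
        refine Finset.sum_congr rfl fun z _ => ?_
        rw [Finset.mul_sum, Finset.mul_sum, ← Finset.sum_sub_distrib, Finset.smul_sum]
        refine Finset.sum_congr rfl fun u _ => ?_
        rw [wedge_add_self_right]
        unfold wedge
        simp only [Int.cast_sub, Int.cast_mul, Matrix.mul_smul, Matrix.smul_mul, smul_smul, ← sub_smul]
        congr 1
        ring
    _ = -(Complex.I • (euclideanGamma 0 * euclideanGamma 1)) := by
        rw [Finset.sum_sub_distrib, ← Finset.sum_mul, ← Finset.sum_mul, sum_smul_dsharp, sum_smul_dsharp,
          sum_smul_dsymb, sum_smul_dsymb, Matrix.neg_mul, Matrix.neg_mul,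
          euclideanGamma_mul_of_ne (show (1 : Fin 4) ≠ 0 by decide), sub_neg_eq_add, ← neg_add,
          ← two_smul ℂ, smul_neg, smul_smul, show Complex.I / 2 * 2 = Complex.I by ring]

/-- `tr[(−iγ₀γ₁)²] = 4`. -/
theorem trace_vertexOne_sq :
    Matrix.trace (-(Complex.I • (euclideanGamma 0 * euclideanGamma 1)) *
      -(Complex.I • (euclideanGamma 0 * euclideanGamma 1))) = 4 := by
  have hprod : euclideanGamma 0 * euclideanGamma 1 * (euclideanGamma 0 * euclideanGamma 1) = -(1 : Spin) := by
    rw [Matrix.mul_assoc, ← Matrix.mul_assoc (euclideanGamma 1) (euclideanGamma 0),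
      euclideanGamma_mul_of_ne (show (1 : Fin 4) ≠ 0 by decide), Matrix.neg_mul, Matrix.mul_neg,
      Matrix.mul_assoc, euclideanGamma_mul_self, Matrix.mul_one, euclideanGamma_mul_self]
  rw [neg_mul_neg, Matrix.smul_mul, Matrix.mul_smul, smul_smul, hprod, Matrix.trace_smul, Matrix.trace_neg,
    Matrix.trace_one, Fintype.card_fin, Complex.I_mul_I]
  norm_num

/-- The second-order trace: `Σ_{v,v'} tr[η(v) η(v')] = 4`, where
`η(v) = Σ_{z ∈ nbr 0} (i/2)(z∧v) ď♯(z) ď(v−z)` is the first-order vertex. -/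
theorem sum_sum_trace_vertexOne_mul :
    ∑ v ∈ nbr2 0, ∑ v' ∈ nbr2 0, Matrix.trace
      ((∑ z ∈ nbr 0, (Complex.I / 2 * ((wedge z v : ℤ) : ℂ)) • (dsharp z * dsymb (v - z))) *
        (∑ z ∈ nbr 0, (Complex.I / 2 * ((wedge z v' : ℤ) : ℂ)) • (dsharp z * dsymb (v' - z)))) = 4 := by
  simp only [← Matrix.trace_sum, ← Finset.mul_sum, ← Finset.sum_mul]
  rw [sum_vertexOne, trace_vertexOne_sq]

/-! ## Registered headline -/

/-- Registered headline of this helper file (aux stub `stub_secondOrderCoefficientAux` of crux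
stmt-QuantumFields-16786, line `Sketch`): the second moments of the free symbol coefficients `ĥ`. -/
theorem stub_secondOrderCoefficientAux :
    ∀ (hsq : ∀ x y : Site 4, sqKer (fun _ => (1 : ℂ)) x y = ((hhat (y - x) : ℝ) : ℂ) • (1 : Spin)) (μ ν : Fin 4),
      ∑ v ∈ nbr2 0, ((v μ : ℤ) : ℝ) * ((v ν : ℤ) : ℝ) * hhat v = if μ = ν then -2 else 0 :=
  fun hsq μ ν => sum_coord_mul_coord_mul_hhat hsq μ ν

end Summit.QuantumFields.QCD.Cruxes.QuarkLoopCoefficient.Sketch.SecondOrderCoefficient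

end
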